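import Summits.Ventures.YMGap.RobustBall.FreeEnergyLawTorus
import Summits.Ventures.YMGap.RobustBall.FreeEnergyLaw
import Summits.Ventures.YMGap.RobustBall.BoundaryDecayTorus
import Summits.Ventures.YMGap.Thresholds.PressureDerivativeSUN
import HarnessLib

/-!
# Venture YMGap, track ROBUST-BALL — «C-FSS» IN EVERY DIMENSION: exponentially small finite-size corrections of the periodic free
# energy of `SU(N)` lattice Yang–Mills on `(ℤ/(L+1))^d`, every `N ≥ 2`, every `d ≥ 2`, 't Hooft `0 ≤ β ≤ 1/(12(d−1))`

HONEST FRAMING. WHAT THIS IS: a venture file (cell `pub-ymgap`, track Y2 ROBUST-BALL / DS, seat ds-3, theorems only, 0 compute): the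
every-dimension cell of `TorusFreeEnergyRate.lean` («C-FSS», there `d = 4`). `SU(N)` on the torus `(ℤ/(L+1))^d`, Wilson action at tree coupling
`N β`, 't Hooft `0 ≤ β ≤ 1/(12(d−1))` (ds-1's every-`d` `C¹` window), ratio `max(ρ, ½)` for any `6(d−1)β/(½ − 2(d−1)β) ≤ ρ < 1` (rb-p1's
hypothesis-free Bakry–Émery single-link door in every dimension, through the seat's `suN_wilson_torus_bakryEmery`):
* `plaquetteEdges_zero_subset_boxLinks_dim`, `torusPressure_zero_dim`, `suN_abs_torus_plaquette_sub_le_dim` (per plane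
  `|⟨Re tr U_{(0;i,j)}⟩_{(ℤ/L)^d} − μ(Re tr U_{(0;i,j)})| ≤ 32 N⁴ √N · max(ρ,½)^{n−1}`);
* ★★ `suN_abs_torusPressure_sub_freeEnergyDensity_le_dim` — for every `1 ≤ n` and torus side `L + 1 > 2(n+1)`:
  `| |Λ_{L+1}|⁻¹ log Z_{Λ_{L+1}, Nβ} − f(Nβ) | ≤ N β · #planes(d) · 32 N⁴ √N · max(ρ,½)^{n−1}`, `#planes(d) = d(d−1)/2`, `f = freeEnergyDensity d ρ_N`:
  EXPONENTIALLY SMALL FINITE-SIZE CORRECTIONS IN EVERY DIMENSION (in particular `d = 3`, the Y4 interface dimension), HYPOTHESIS-FREE.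
MECHANISM: as in `d = 4` — rb-p2's `FreeEnergyLaw.hasDerivAt_torusPressure` against ds-1's every-`d` thermodynamic identity
`PressureRegularity.hasDerivWithinAt_freeEnergyDensity_dim_thooft`, the SAME planes on both sides, the seat's torus one-state rate, the mean
value inequality on `[0, Nβ]`, `log Z_{Λ,0} = f(0) = 0`.
WHAT THIS IS NOT: lattice strong coupling; rates are Dobrushin-comparison artefacts; nothing about the continuum limit or Clay. [folklore]
-/

noncomputable section

open MeasureTheory ProbabilityTheory Filter Topology Real Finset Set
open scoped NNReal
open Literature.Probability.LatticeModels hiding configShift configShift_apply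
open Literature.MathematicalPhysics.QuantumLattice
open Literature.MathematicalPhysics.QuantumFieldTheory (IsLipschitzCylinder isLipschitzCylinder_zdPlaquetteObs zdPlaquetteObs
  wilsonExpectation card_plaquetteEdges_le)
open Summit.Ventures.YMGap.CouplingResponse (plaquetteObs_fundamentalRep_eq_mul_zdPlaquetteObs)

namespace Summit.Ventures.YMGap.RobustBall

namespace TorusFreeEnergyRate

variable {d N : ℕ}

/-- The four links of the plaquette `(0; i<j)` are based in the box `[−1, 1]^d`, every `d`. [folklore] -/
theorem plaquetteEdges_zero_subset_boxLinks_dim {i j : Fin d} (hij : i < j) :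
    plaquetteEdges (((0 : Site d), ⟨(i, j), hij⟩) : ZdPlaquette d) ⊆ boxLinks d 1 := by
  intro e he
  rw [mem_boxLinks, mem_siteBox_iff_norm]
  simp only [plaquetteEdges, Finset.mem_insert, Finset.mem_singleton, zero_add] at he
  rcases he with rfl | rfl | rfl | rfl
  · simp
  · rw [Pi.norm_single]; simp
  · rw [Pi.norm_single]; simp
  · simp

/-- `log Z_{Λ_{L+1}, 0} = 0` in the per-site form, every `d`. [folklore] -/
theorem torusPressure_zero_dim (hρN : Continuous (fundamentalRep (Fin N))) (L : ℕ) :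
    (((L + 1 : ℕ) : ℝ) ^ d)⁻¹ * torusLogPartition d (fundamentalRep (Fin N)) 0 (L + 1) = 0 := by
  rw [FreeEnergyLaw.torusPressure_eq_integral (d := d) (fundamentalRep (Fin N)) hρN L 0, intervalIntegral.integral_same]
  ring

/-- **Per-plane torus error, every `N ≥ 2`, every `d ≥ 1`** ('t Hooft `|β|` with `2(d−1)|β| < 1/2`, tree coupling `N β`, ratio `max(ρ,½)`,
`6(d−1)|β|/(½ − 2(d−1)|β|) ≤ ρ < 1`, `μ` a DLR state, `1 ≤ n`, torus side `L > 2(n+1)`):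
`|⟨Re tr U_{(0;i,j)}⟩_{(ℤ/L)^d} − μ(Re tr U_{(0;i,j)})| ≤ 32 N⁴ √N · max(ρ,½)^{n−1}`. [folklore] -/
theorem suN_abs_torus_plaquette_sub_le_dim (hd : 1 ≤ d) (hN : 2 ≤ N) {β ρ : ℝ} (hb : |β| * (2 * ((d : ℝ) - 1)) < 1 / 2)
    (hρ : 6 * ((d : ℝ) - 1) * |β| / (1 / 2 - |β| * (2 * ((d : ℝ) - 1))) ≤ ρ) (hρ1 : ρ < 1)
    {μ : Measure (LGConfig d (Matrix.specialUnitaryGroup (Fin N) ℂ))}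
    (hμ : μ ∈ ymGibbsMeasures (d := d) (fundamentalRep (Fin N)) (N * β)) {n L : ℕ} [NeZero L] (hn : 1 ≤ n)
    (hL : 2 * (n + 1) < L) {i j : Fin d} (hij : i < j) :
    |wilsonExpectation (fundamentalRep (Fin N)) (N * β)
          (toTorusObservable L (plaquetteObs (fundamentalRep (Fin N)) (0 : Site d) i j)) -
        ∫ U, plaquetteObs (fundamentalRep (Fin N)) 0 i j U ∂μ| ≤
      32 * (N : ℝ) ^ 4 * Real.sqrt N * (max ρ (1 / 2)) ^ (n - 1) := by
  have hF := isLipschitzCylinder_zdPlaquetteObs (d := d) (N := N) (0 : Site d) hij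
  have key := suN_wilson_torus_bakryEmery hd hN hb hρ hρ1 hμ hn hL hF (plaquetteEdges_zero_subset_boxLinks_dim hij)
  have hcard : ((plaquetteEdges (((0 : Site d), ⟨(i, j), hij⟩) : ZdPlaquette d)).card : ℝ) ≤ 4 := by
    exact_mod_cast card_plaquetteEdges_le _
  have hN0 : (0 : ℝ) ≤ N := Nat.cast_nonneg N
  have hT : wilsonExpectation (fundamentalRep (Fin N)) (N * β)
        (toTorusObservable L (plaquetteObs (fundamentalRep (Fin N)) (0 : Site d) i j)) =
      N * wilsonExpectation (fundamentalRep (Fin N)) (N * β)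
        (toTorusObservable L (zdPlaquetteObs (d := d) (fundamentalRep (Fin N)) (0 : Site d) i j)) := by
    unfold wilsonExpectation
    rw [← integral_const_mul]
    refine integral_congr_ae (ae_of_all _ fun V => ?_)
    simp only [toTorusObservable, Function.comp_apply]
    rw [plaquetteObs_fundamentalRep_eq_mul_zdPlaquetteObs]
  have hD : (∫ U, plaquetteObs (fundamentalRep (Fin N)) 0 i j U ∂μ) =
      N * ∫ U, zdPlaquetteObs (d := d) (fundamentalRep (Fin N)) (0 : Site d) i j U ∂μ := by
    rw [← integral_const_mul]
    exact integral_congr_ae (ae_of_all _ fun U => plaquetteObs_fundamentalRep_eq_mul_zdPlaquetteObs _ _ _ U)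
  rw [hT, hD, ← mul_sub, abs_mul, Nat.abs_cast]
  calc (N : ℝ) * |wilsonExpectation (fundamentalRep (Fin N)) (N * β)
            (toTorusObservable L (zdPlaquetteObs (d := d) (fundamentalRep (Fin N)) (0 : Site d) i j)) -
          ∫ U, zdPlaquetteObs (d := d) (fundamentalRep (Fin N)) (0 : Site d) i j U ∂μ|
      ≤ N * (2 * Real.sqrt N * ((4 * (N : ℝ≥0) ^ 3 : ℝ≥0) : ℝ) *
          (plaquetteEdges (((0 : Site d), ⟨(i, j), hij⟩) : ZdPlaquette d)).card * (max ρ (1 / 2)) ^ (n - 1)) :=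
        mul_le_mul_of_nonneg_left key hN0
    _ ≤ N * (2 * Real.sqrt N * ((4 * (N : ℝ≥0) ^ 3 : ℝ≥0) : ℝ) * 4 * (max ρ (1 / 2)) ^ (n - 1)) := by gcongr
    _ = 32 * (N : ℝ) ^ 4 * Real.sqrt N * (max ρ (1 / 2)) ^ (n - 1) := by push_cast; ring

/-- ★★ **«C-FSS» IN EVERY DIMENSION** (`SU(N)`, `N ≥ 2`, `d ≥ 2`, Wilson action, 't Hooft `0 ≤ β ≤ 1/(12(d−1))`, tree coupling `N β`, ratio
`max(ρ,½)` with `6(d−1)β/(½ − 2(d−1)β) ≤ ρ < 1`, every `1 ≤ n`, torus side `L + 1 > 2(n+1)`):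
`| |Λ_{L+1}|⁻¹ log Z_{Λ_{L+1}, Nβ} − f(Nβ) | ≤ N β · #planes(d) · 32 N⁴ √N · max(ρ,½)^{n−1}` — HYPOTHESIS-FREE. [folklore] -/
theorem suN_abs_torusPressure_sub_freeEnergyDensity_le_dim (hd : 2 ≤ d) (hN : 2 ≤ N) {β ρ : ℝ} (hβ0 : 0 ≤ β)
    (hβ : β ≤ 1 / (12 * ((d : ℝ) - 1)))
    (hρ : 6 * ((d : ℝ) - 1) * β / (1 / 2 - β * (2 * ((d : ℝ) - 1))) ≤ ρ) (hρ1 : ρ < 1) {n L : ℕ} (hn : 1 ≤ n)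
    (hL : 2 * (n + 1) < L + 1) :
    |(((L + 1 : ℕ) : ℝ) ^ d)⁻¹ * torusLogPartition d (fundamentalRep (Fin N)) (N * β) (L + 1) -
        freeEnergyDensity d (fundamentalRep (Fin N)) (N * β)| ≤
      N * β * ((Fintype.card {q : Fin d × Fin d // q.1 < q.2} : ℝ) * (32 * (N : ℝ) ^ 4 * Real.sqrt N * (max ρ (1 / 2)) ^ (n - 1))) := by
  have hρc : Continuous (fundamentalRep (Fin N)) := continuous_fundamentalRep (Fin N)
  have hN0 : (0 : ℝ) < N := by exact_mod_cast (show 0 < N by omega)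
  have hd1 : (1 : ℝ) ≤ (d : ℝ) - 1 := by
    have : (2 : ℝ) ≤ d := by exact_mod_cast hd
    linarith
  have hd0 : (0 : ℝ) < (d : ℝ) - 1 := by linarith
  set C : ℝ := (Fintype.card {q : Fin d × Fin d // q.1 < q.2} : ℝ) * (32 * (N : ℝ) ^ 4 * Real.sqrt N * (max ρ (1 / 2)) ^ (n - 1))
    with hC
  set P : ℝ → ℝ := fun s => (((L + 1 : ℕ) : ℝ) ^ d)⁻¹ * torusLogPartition d (fundamentalRep (Fin N)) s (L + 1) with hP
  set f : ℝ → ℝ := freeEnergyDensity d (fundamentalRep (Fin N)) with hf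
  set D : ℝ → ℝ := fun s => P s - f s with hD
  set w : ℝ := (N : ℝ) / (12 * ((d : ℝ) - 1)) with hw
  have hwin : (N : ℝ) * β ≤ w := by
    rw [hw, le_div_iff₀ (by positivity)]
    have h1 : β * (12 * ((d : ℝ) - 1)) ≤ 1 := by
      rw [le_div_iff₀ (by positivity)] at hβ; linarith
    nlinarith
  -- a DLR selection on the closed window
  have hex : ∀ s : ℝ, ∃ ν : Measure (LGConfig d (Matrix.specialUnitaryGroup (Fin N) ℂ)),
      s ∈ Icc (0 : ℝ) w → ν ∈ ymGibbsMeasures (d := d) (fundamentalRep (Fin N)) s := by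
    intro s
    by_cases hs : s ∈ Icc (0 : ℝ) w
    · haveI : SecondCountableTopology (Matrix.specialUnitaryGroup (Fin N) ℂ) :=
        haveI : SecondCountableTopology (Matrix (Fin N) (Fin N) ℂ) :=
          inferInstanceAs (SecondCountableTopology (Fin N → Fin N → ℂ))
        Topology.IsEmbedding.subtypeVal.secondCountableTopology
      obtain ⟨ν, hν⟩ := Literature.MathematicalPhysics.QuantumFieldTheory.ymGibbsMeasures_nonempty (d := d)
        (fundamentalRep (Fin N)) hρc s
      exact ⟨ν, fun _ => hν⟩
    · exact ⟨0, fun h => absurd h hs⟩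
  choose ν hν using hex
  have hDer : ∀ s ∈ Icc (0 : ℝ) w, HasDerivWithinAt D
      (∑ q : {q : Fin d × Fin d // q.1 < q.2},
        (wilsonExpectation (fundamentalRep (Fin N)) s
            (toTorusObservable (L + 1) (plaquetteObs (fundamentalRep (Fin N)) (0 : Site d) q.1.1 q.1.2)) -
          ∫ U, plaquetteObs (fundamentalRep (Fin N)) 0 q.1.1 q.1.2 U ∂(ν s))) (Icc (0 : ℝ) w) s := by
    intro s hs
    have h1 := (FreeEnergyLaw.hasDerivAt_torusPressure (d := d) (fundamentalRep (Fin N)) hρc L s).hasDerivWithinAt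
      (s := Icc (0 : ℝ) w)
    have h2 := PressureRegularity.hasDerivWithinAt_freeEnergyDensity_dim_thooft hd hN hν hs
    refine (h1.fun_sub h2).congr_deriv ?_
    rw [Finset.sum_sub_distrib, Finset.sum_sub_distrib, Finset.sum_const, Finset.card_univ, nsmul_eq_mul]
    ring
  have hsub : Icc (0 : ℝ) (N * β) ⊆ Icc (0 : ℝ) w := Icc_subset_Icc_right hwin
  have hD' : ∀ s ∈ Icc (0 : ℝ) (N * β),
      ‖∑ q : {q : Fin d × Fin d // q.1 < q.2},
        (wilsonExpectation (fundamentalRep (Fin N)) s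
            (toTorusObservable (L + 1) (plaquetteObs (fundamentalRep (Fin N)) (0 : Site d) q.1.1 q.1.2)) -
          ∫ U, plaquetteObs (fundamentalRep (Fin N)) 0 q.1.1 q.1.2 U ∂(ν s))‖ ≤ C := by
    intro s hs
    set β' : ℝ := s / N with hβ'
    have hsN : (N : ℝ) * β' = s := by rw [hβ']; field_simp
    have hβ'0 : 0 ≤ β' := by rw [hβ']; exact div_nonneg hs.1 hN0.le
    have hβ'le : β' ≤ β := by rw [hβ', div_le_iff₀ hN0]; linarith [hs.2]
    have hb' : |β'| * (2 * ((d : ℝ) - 1)) < 1 / 2 := by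
      rw [abs_of_nonneg hβ'0]
      have h1 : β * (12 * ((d : ℝ) - 1)) ≤ 1 := by rw [le_div_iff₀ (by positivity)] at hβ; linarith
      nlinarith
    have hρ' : 6 * ((d : ℝ) - 1) * |β'| / (1 / 2 - |β'| * (2 * ((d : ℝ) - 1))) ≤ ρ := by
      rw [abs_of_nonneg hβ'0]
      refine le_trans ?_ hρ
      have h1 : β * (12 * ((d : ℝ) - 1)) ≤ 1 := by rw [le_div_iff₀ (by positivity)] at hβ; linarith
      have hden : 0 < 1 / 2 - β * (2 * ((d : ℝ) - 1)) := by nlinarith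
      have hden' : 0 < 1 / 2 - β' * (2 * ((d : ℝ) - 1)) := by nlinarith
      rw [div_le_div_iff₀ hden' hden]
      nlinarith [mul_nonneg hβ'0 hd0.le, mul_nonneg hβ0 hd0.le]
    have hμs : ν s ∈ ymGibbsMeasures (d := d) (fundamentalRep (Fin N)) (N * β') := by rw [hsN]; exact hν s (hsub hs)
    rw [Real.norm_eq_abs]
    refine (Finset.abs_sum_le_sum_abs _ _).trans ?_
    calc ∑ q : {q : Fin d × Fin d // q.1 < q.2},
          |wilsonExpectation (fundamentalRep (Fin N)) s
              (toTorusObservable (L + 1) (plaquetteObs (fundamentalRep (Fin N)) (0 : Site d) q.1.1 q.1.2)) -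
            ∫ U, plaquetteObs (fundamentalRep (Fin N)) 0 q.1.1 q.1.2 U ∂(ν s)|
        ≤ ∑ _q : {q : Fin d × Fin d // q.1 < q.2}, 32 * (N : ℝ) ^ 4 * Real.sqrt N * (max ρ (1 / 2)) ^ (n - 1) :=
          Finset.sum_le_sum fun q _ => by
            have h := suN_abs_torus_plaquette_sub_le_dim (d := d) (by omega) hN hb' hρ' hρ1 hμs hn hL q.2
            rwa [hsN] at h
      _ = C := by rw [Finset.sum_const, Finset.card_univ, nsmul_eq_mul, hC]
  have hNβ : 0 ≤ (N : ℝ) * β := by positivity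
  have hMVT := Convex.norm_image_sub_le_of_norm_hasDerivWithin_le (f := D) (s := Icc (0 : ℝ) (N * β))
    (fun s hs => (hDer s (hsub hs)).mono hsub) hD' (convex_Icc _ _) (left_mem_Icc.2 hNβ) (right_mem_Icc.2 hNβ)
  have hf0 : f 0 = 0 := by
    have h := FreeEnergyLaw.freeEnergyDensity_two_sided (d := d) (fundamentalRep (Fin N))
      (Literature.MathematicalPhysics.QuantumFieldTheory.TorusAreaLaw.isSpecialUnitaryModel_fundamentalRep N) hN hd (le_refl (0 : ℝ))
    simp only [mul_zero, zero_pow two_ne_zero, zero_div, add_zero, neg_zero, Real.exp_zero, mul_one] at h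
    exact le_antisymm h.2 h.1
  have hD0 : D 0 = 0 := by
    show P 0 - f 0 = 0
    rw [hf0, sub_zero]
    exact torusPressure_zero_dim hρc L
  rw [hD0, sub_zero, sub_zero, Real.norm_eq_abs, Real.norm_eq_abs, abs_of_nonneg hNβ] at hMVT
  calc |D (N * β)| ≤ C * (N * β) := hMVT
    _ = N * β * C := mul_comm _ _

end TorusFreeEnergyRate

end Summit.Ventures.YMGap.RobustBall

end
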